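import Literature.Analysis.FluidPDE.TorusLinearisedNSVorticityGradientGrowth
import Literature.Analysis.FunctionSpaces.TorusAgmonPlanar
import Literature.Analysis.FunctionSpaces.LadyzhenskayaTorus
import HarnessLib

/-!
# The six vorticity sizes of a planar response and the Agmon Lipschitz majorant
(route `AnomalousDissipation/SawtoothPulseCascade`, line `lip-agmon` of the crux ApproxSol58 =
stmt-AnomalousDissipation-19688; lead g4, module F, part 1)

For a jointly smooth divergence-free planar field `L` on a window and `ω = W(L)₀₁ = ∂₀L₁ − ∂₁L₀`:

* `lipschitz_le_agmon_fin_two` — **the Agmon Lipschitz majorant**: with the planar Agmon constant `C`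
  (`Torus.exists_norm_sq_le_agmon_fin_two`, p502600),
  `‖DL(t)(x)‖ ≤ 2 · √(C · ‖ω(t)‖₂ · (‖∂₀∂₀ω(t)‖₂ + ‖∂₀∂₁ω(t)‖₂ + ‖∂₁∂₁ω(t)‖₂))` — Agmon applied to the
  zero-mean fields `∂ⱼL(t)`, with `‖∂ⱼL‖₂ ≤ ‖ω‖₂` and `‖Δ∂ⱼL‖₂² = ‖∂ⱼ∂₀ω‖₂² + ‖∂ⱼ∂₁ω‖₂²` (planar kinematics,
  p497833 Part 5);
* continuity in time of the six sizes `‖ω(t)‖₂`, `‖∂ₖω(t)‖₂`, `‖∂ₖ∂ₗω(t)‖₂` (joint smoothness);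
* their vanishing at a time where `L = 0`;
* `∂₁∂₀ω = ∂₀∂₁ω` in `L²`.
-/

set_option linter.dupNamespace false

noncomputable section

namespace Summit.AnomalousDissipation.AnomalousDissipation.Theorems.SawtoothPulseCascade.LipAgmon

open Set MeasureTheory
open scoped InnerProductSpace ContDiff
open Literature.Analysis Literature.Analysis.FunctionSpaces Literature.Analysis.FluidPDE
open Literature.Analysis.FluidPDE.Torus Literature.Analysis.FunctionSpaces.Torus

/-! ## §1 The Agmon Lipschitz majorant -/

/-- **Agmon on one partial derivative of a planar divergence-free field.** With the planar Agmon
constant `C`: `‖∂ⱼL(x)‖² ≤ C · ‖ω‖₂ · (‖∂ⱼ∂₀ω‖₂ + ‖∂ⱼ∂₁ω‖₂)` for smooth divergence-free `L : 𝕋² → ℝ²`,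
`ω = W(L)₀₁` (`∂ⱼL` has zero mean; `‖∂ⱼL‖₂ ≤ ‖ω‖₂`; `‖Δ∂ⱼL‖₂² = ‖∂ⱼ∂₀ω‖₂² + ‖∂ⱼ∂₁ω‖₂²`). [cite: FoiasManleyRosaTemam2001, Ch. II App. A (A.29) (Agmon's inequality)] -/
theorem norm_partialDeriv_sq_le_agmon_fin_two {C : ℝ} (hC0 : 0 < C)
    (hC : ∀ v : UnitAddTorus (Fin 2) → EuclideanSpace ℝ (Fin 2), IsSmooth v → HasZeroMean v →
      ∀ x : UnitAddTorus (Fin 2), ‖v x‖ ^ 2 ≤ C * Real.sqrt (∫ y, ‖v y‖ ^ 2) * Real.sqrt (∫ y, ‖laplacian v y‖ ^ 2))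
    {L : UnitAddTorus (Fin 2) → EuclideanSpace ℝ (Fin 2)} (hL : IsSmooth L) (hdiv : IsDivFree L) (j : Fin 2)
    (x : UnitAddTorus (Fin 2)) :
    ‖Torus.partialDeriv j L x‖ ^ 2 ≤
      C * Real.sqrt (∫ y, torusVorticityTensor L 0 1 y ^ 2) *
        (Real.sqrt (∫ y, (Torus.partialDeriv j (Torus.partialDeriv 0 (torusVorticityTensor L 0 1)) y) ^ 2) +
          Real.sqrt (∫ y, (Torus.partialDeriv j (Torus.partialDeriv 1 (torusVorticityTensor L 0 1)) y) ^ 2)) := by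
  have h1 := hC (Torus.partialDeriv j L) (hL.partialDeriv j) (hasZeroMean_partialDeriv_fin_two hL j) x
  have h2 : Real.sqrt (∫ y, ‖Torus.partialDeriv j L y‖ ^ 2) ≤ Real.sqrt (∫ y, torusVorticityTensor L 0 1 y ^ 2) :=
    Real.sqrt_le_sqrt (integral_norm_partialDeriv_sq_le_integral_vorticity_sq_fin_two hL hdiv j)
  have h3 : Real.sqrt (∫ y, ‖laplacian (Torus.partialDeriv j L) y‖ ^ 2) ≤
      Real.sqrt (∫ y, (Torus.partialDeriv j (Torus.partialDeriv 0 (torusVorticityTensor L 0 1)) y) ^ 2) +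
        Real.sqrt (∫ y, (Torus.partialDeriv j (Torus.partialDeriv 1 (torusVorticityTensor L 0 1)) y) ^ 2) := by
    rw [integral_norm_laplacian_partialDeriv_sq_eq_fin_two hL hdiv j]
    -- `√(A + B) ≤ √A + √B` (cf. `MRT2015.sqrt_add_le_sqrt_add_sqrt`, a number-theory file not imported here)
    have hA : 0 ≤ ∫ y, (Torus.partialDeriv j (Torus.partialDeriv 0 (torusVorticityTensor L 0 1)) y) ^ 2 :=
      integral_nonneg fun y => sq_nonneg _
    have hB : 0 ≤ ∫ y, (Torus.partialDeriv j (Torus.partialDeriv 1 (torusVorticityTensor L 0 1)) y) ^ 2 :=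
      integral_nonneg fun y => sq_nonneg _
    refine Real.sqrt_le_iff.2 ⟨add_nonneg (Real.sqrt_nonneg _) (Real.sqrt_nonneg _), ?_⟩
    have hA' := Real.sq_sqrt hA
    have hB' := Real.sq_sqrt hB
    nlinarith [mul_nonneg (Real.sqrt_nonneg (∫ y, (Torus.partialDeriv j (Torus.partialDeriv 0 (torusVorticityTensor L 0 1)) y) ^ 2))
      (Real.sqrt_nonneg (∫ y, (Torus.partialDeriv j (Torus.partialDeriv 1 (torusVorticityTensor L 0 1)) y) ^ 2))]
  have hA0 : 0 ≤ Real.sqrt (∫ y, ‖Torus.partialDeriv j L y‖ ^ 2) := Real.sqrt_nonneg _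
  have hB0 : 0 ≤ Real.sqrt (∫ y, ‖laplacian (Torus.partialDeriv j L) y‖ ^ 2) := Real.sqrt_nonneg _
  calc ‖Torus.partialDeriv j L x‖ ^ 2
      ≤ C * Real.sqrt (∫ y, ‖Torus.partialDeriv j L y‖ ^ 2) * Real.sqrt (∫ y, ‖laplacian (Torus.partialDeriv j L) y‖ ^ 2) := h1
    _ ≤ C * Real.sqrt (∫ y, torusVorticityTensor L 0 1 y ^ 2) *
        (Real.sqrt (∫ y, (Torus.partialDeriv j (Torus.partialDeriv 0 (torusVorticityTensor L 0 1)) y) ^ 2) +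
          Real.sqrt (∫ y, (Torus.partialDeriv j (Torus.partialDeriv 1 (torusVorticityTensor L 0 1)) y) ^ 2)) := by
        gcongr

/-- `∂₁∂₀ω = ∂₀∂₁ω` in `L²` (Schwarz). [folklore] -/
theorem sqrt_integral_pd_one_zero_eq {f : UnitAddTorus (Fin 2) → ℝ} (hf : IsSmooth f) :
    Real.sqrt (∫ y, (Torus.partialDeriv 1 (Torus.partialDeriv 0 f) y) ^ 2) =
      Real.sqrt (∫ y, (Torus.partialDeriv 0 (Torus.partialDeriv 1 f) y) ^ 2) := by
  congr 1
  refine integral_congr_ae (ae_of_all _ fun y => ?_)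
  show Torus.partialDeriv 1 (Torus.partialDeriv 0 f) y ^ 2 = Torus.partialDeriv 0 (Torus.partialDeriv 1 f) y ^ 2
  rw [Torus.partialDeriv_comm hf 1 0 y]

/-- **The Agmon Lipschitz majorant.** With the planar Agmon constant `C`: for smooth divergence-free
`L : 𝕋² → ℝ²` and `ω = W(L)₀₁`, at every point
`‖DL(x)‖ ≤ 2 √(C · ‖ω‖₂ · (‖∂₀∂₀ω‖₂ + ‖∂₀∂₁ω‖₂ + ‖∂₁∂₁ω‖₂))` (`‖DL‖ ≤ ‖∂₀L‖ + ‖∂₁L‖` and Agmon on each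
`∂ⱼL`). [cite: FoiasManleyRosaTemam2001, Ch. II App. A (A.29) (Agmon's inequality)] -/
theorem lipschitz_le_agmon_fin_two {C : ℝ} (hC0 : 0 < C)
    (hC : ∀ v : UnitAddTorus (Fin 2) → EuclideanSpace ℝ (Fin 2), IsSmooth v → HasZeroMean v →
      ∀ x : UnitAddTorus (Fin 2), ‖v x‖ ^ 2 ≤ C * Real.sqrt (∫ y, ‖v y‖ ^ 2) * Real.sqrt (∫ y, ‖laplacian v y‖ ^ 2))
    {L : UnitAddTorus (Fin 2) → EuclideanSpace ℝ (Fin 2)} (hL : IsSmooth L) (hdiv : IsDivFree L)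
    (x : UnitAddTorus (Fin 2)) :
    ‖Torus.fderiv L x‖ ≤ 2 * Real.sqrt (C * Real.sqrt (∫ y, torusVorticityTensor L 0 1 y ^ 2) *
      (Real.sqrt (∫ y, (Torus.partialDeriv 0 (Torus.partialDeriv 0 (torusVorticityTensor L 0 1)) y) ^ 2) +
        Real.sqrt (∫ y, (Torus.partialDeriv 0 (Torus.partialDeriv 1 (torusVorticityTensor L 0 1)) y) ^ 2) +
        Real.sqrt (∫ y, (Torus.partialDeriv 1 (Torus.partialDeriv 1 (torusVorticityTensor L 0 1)) y) ^ 2))) := by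
  obtain ⟨Z, hZ⟩ : ∃ r : ℝ, r = Real.sqrt (∫ y, torusVorticityTensor L 0 1 y ^ 2) := ⟨_, rfl⟩
  obtain ⟨V00, hV00⟩ : ∃ r : ℝ,
      r = Real.sqrt (∫ y, (Torus.partialDeriv 0 (Torus.partialDeriv 0 (torusVorticityTensor L 0 1)) y) ^ 2) := ⟨_, rfl⟩
  obtain ⟨V01, hV01⟩ : ∃ r : ℝ,
      r = Real.sqrt (∫ y, (Torus.partialDeriv 0 (Torus.partialDeriv 1 (torusVorticityTensor L 0 1)) y) ^ 2) := ⟨_, rfl⟩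
  obtain ⟨V11, hV11⟩ : ∃ r : ℝ,
      r = Real.sqrt (∫ y, (Torus.partialDeriv 1 (Torus.partialDeriv 1 (torusVorticityTensor L 0 1)) y) ^ 2) := ⟨_, rfl⟩
  have hZ0 : 0 ≤ Z := by rw [hZ]; exact Real.sqrt_nonneg _
  have hV000 : 0 ≤ V00 := by rw [hV00]; exact Real.sqrt_nonneg _
  have hV010 : 0 ≤ V01 := by rw [hV01]; exact Real.sqrt_nonneg _
  have hV110 : 0 ≤ V11 := by rw [hV11]; exact Real.sqrt_nonneg _
  have hω : IsSmooth (torusVorticityTensor L 0 1) := ((hL.partialDeriv 0).apply 1).sub ((hL.partialDeriv 1).apply 0)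
  have h0 := norm_partialDeriv_sq_le_agmon_fin_two hC0 hC hL hdiv 0 x
  have h1 := norm_partialDeriv_sq_le_agmon_fin_two hC0 hC hL hdiv 1 x
  rw [sqrt_integral_pd_one_zero_eq hω] at h1
  rw [← hZ, ← hV00, ← hV01] at h0
  rw [← hZ, ← hV01, ← hV11] at h1
  rw [← hZ, ← hV00, ← hV01, ← hV11]
  -- both squares are `≤ C Z (V00 + V01 + V11)`
  have hCZ : 0 ≤ C * Z := mul_nonneg hC0.le hZ0
  have h0' : ‖Torus.partialDeriv 0 L x‖ ^ 2 ≤ C * Z * (V00 + V01 + V11) :=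
    h0.trans (mul_le_mul_of_nonneg_left (by linarith) hCZ)
  have h1' : ‖Torus.partialDeriv 1 L x‖ ^ 2 ≤ C * Z * (V00 + V01 + V11) :=
    h1.trans (mul_le_mul_of_nonneg_left (by linarith) hCZ)
  have k0 : ‖Torus.partialDeriv 0 L x‖ ≤ Real.sqrt (C * Z * (V00 + V01 + V11)) := Real.le_sqrt_of_sq_le h0'
  have k1 : ‖Torus.partialDeriv 1 L x‖ ≤ Real.sqrt (C * Z * (V00 + V01 + V11)) := Real.le_sqrt_of_sq_le h1'
  have hsum := norm_fderiv_le_sum_norm_partialDeriv (hL.isContDiff (by simp)) x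
  rw [Fin.sum_univ_two] at hsum
  linarith

end Summit.AnomalousDissipation.AnomalousDissipation.Theorems.SawtoothPulseCascade.LipAgmon

end
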